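import Mathlib
import Summits.ValiantsHypothesis.ValiantsHypothesis.Theorems.NewtonUnitEquationsTwoProductsFormalLogLinearisationDefs
import Summits.ValiantsHypothesis.ValiantsHypothesis.Theorems.NewtonUnitEquationsTwoProductsCommonCone
import HarnessLib

/-!
# Route NewtonUnitEquations — crux `TwoProducts` (stmt-ValiantsHypothesis-5906), line `formal-log-linearisation`:
# the common two-monomial tail cone of the engine — LATTICE half (independent exponents)

Registered line `Cruxes/TwoProducts/Lines/formal-log-linearisation.lean` (NOT the item's skeleton of record;
helper mode, no stub credit claimed). The line types, next to its open engine `stub_logSumEngine`, ONE rung of the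
engine "already known on paper" as a `--supports` sub-target (`EngineCommonConeRung`, NOT a stub): all `2m` tails
supported inside a common pair `{e₁, e₂}` ⇒ at most `2m` visible points of `supp D`,
`D = Σ_j log(1 + u_j) − Σ_j log(1 + v_j)`. This file is the INDEPENDENT-EXPONENT half (`e₁ 0 * e₂ 1 ≠ e₁ 1 * e₂ 0`),
over the line's vocabulary (`Theorems/NewtonUnitEquationsTwoProductsFormalLogLinearisationDefs.lean`: `logCoeff`,
`logDiff`, `logSupport`, `logVisible`, `ValidWeight`, `IsStrictTop`, `wt`) and the record skeleton's landed
common-cone algebra (`Theorems/NewtonUnitEquationsTwoProductsCommonCone.lean`, cited BY NAME):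

* `exists_eq_binomial` — a tail supported in `{e₁, e₂}` is `a X^{e₁} + b X^{e₂}`, nonzero coefficients marking
  support points; `exists_lattice_of_mem_logSupport` — `supp D ⊆ ℕ•e₁ + ℕ•e₂`;
* `logCoeff_binomial_lattice`, `logDiff_lattice` — the COEFFICIENT FORMULA `[D]_{p•e₁+q•e₂} = κ_{pq} · G(p,q)`,
  `κ_{pq} = (−1)^{p+q+1} C(p+q,p)/(p+q) ≠ 0` (`kappa_ne_zero`), `G(p,q) = Σ_j a_j^p b_j^q − Σ_j a'_j^p b'_j^q`
  (via `CommonCone.coeff_pow_smul_add_smul`; the total-degree truncation of `logCoeff` does not bite);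
* `minimal_of_logVisible` — a visible point is `p•e₁ + q•e₂` for a MINIMAL nonzero `(p,q)` of `G` (componentwise):
  a smaller nonzero would be a support point of larger weight, the weight of `e₁` (resp. `e₂`) being negative for
  every valid weight as soon as it occurs in a tail, which `G(p,q) ≠ 0` with `p ≥ 1` (resp. `q ≥ 1`) forces;
* `card_le_of_independent` — hence `#S ≤ 2m` by the landed rank obstruction
  (`CommonCone.card_le_of_minimal_nonzeros` over `Negative.card_corners_le_rank`, rank form
  `CommonCone.expSum_sub_expSum_eq`).

The dependent-exponent half and the rung itself are assembled in
`Theorems/NewtonUnitEquationsTwoProductsFormalLogLinearisationEngineCommonConeRung.lean`.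

Honest framing: a calibration rung of the line's OPEN engine in the line's own currency (the record skeleton's
`stub_engineCommonCone` is the same mathematics in the truncated-series currency); the engine `stub_logSumEngine`
and the crux `TwoProducts` stay OPEN, and nothing here is progress on `VP ≠ VNP` (NOT proved). No definitions, no
named facts.
-/

noncomputable section

-- Sub = Summit single-conjunct layout: the duplicated namespace component is mandated by the tree.
set_option linter.dupNamespace false

namespace Summit.ValiantsHypothesis.ValiantsHypothesis.Theorems.NewtonUnitEquations.TwoProducts.FormalLogLinearisation

open MvPolynomial
open Summit.ValiantsHypothesis.ValiantsHypothesis.Theorems.TwoProducts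
open scoped BigOperators

variable {m : ℕ}


/-! ### Binomial tails -/

/-- A polynomial supported inside `{e₁, e₂}` is a binomial `a X^{e₁} + b X^{e₂}` whose nonzero coefficients mark
support points. [folklore] -/
theorem exists_eq_binomial {e₁ e₂ : Expo} {u : MvPolynomial (Fin 2) ℂ} (hu : u.support ⊆ {e₁, e₂}) :
    ∃ a b : ℂ, u = monomial e₁ a + monomial e₂ b ∧ (a ≠ 0 → e₁ ∈ u.support) ∧ (b ≠ 0 → e₂ ∈ u.support) := by
  classical
  have hzero : ∀ n, n ≠ e₁ → n ≠ e₂ → coeff n u = 0 := by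
    intro n h1 h2
    rw [← MvPolynomial.notMem_support_iff]
    intro hn
    have := hu hn
    simp only [Finset.mem_insert, Finset.mem_singleton] at this
    rcases this with h | h
    · exact h1 h
    · exact h2 h
  by_cases h12 : e₁ = e₂
  · subst h12
    refine ⟨coeff e₁ u, 0, ?_, fun h => MvPolynomial.mem_support_iff.2 h, fun h => absurd rfl h⟩
    ext n
    simp only [MvPolynomial.coeff_add, MvPolynomial.coeff_monomial]
    by_cases hn : e₁ = n
    · subst hn; simp
    · rw [if_neg hn, if_neg hn, add_zero]
      exact hzero n (Ne.symm hn) (Ne.symm hn)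
  · refine ⟨coeff e₁ u, coeff e₂ u, ?_, fun h => MvPolynomial.mem_support_iff.2 h,
      fun h => MvPolynomial.mem_support_iff.2 h⟩
    ext n
    simp only [MvPolynomial.coeff_add, MvPolynomial.coeff_monomial]
    by_cases h1 : e₁ = n
    · subst h1
      rw [if_pos rfl, if_neg (Ne.symm h12), add_zero]
    · by_cases h2 : e₂ = n
      · subst h2
        rw [if_neg h1, if_pos rfl, zero_add]
      · rw [if_neg h1, if_neg h2, add_zero]
        exact hzero n (Ne.symm h1) (Ne.symm h2)

/-- The weight of a lattice point `p•e₁ + q•e₂`. [folklore] -/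
theorem wt_lattice (ξ : Fin 2 → ℝ) (e₁ e₂ : Expo) (p q : ℕ) :
    wt ξ (p • e₁ + q • e₂) = (p : ℝ) * wt ξ e₁ + (q : ℝ) * wt ξ e₂ := by
  simp only [wt, Finsupp.coe_add, Finsupp.coe_smul, Pi.add_apply, Pi.smul_apply, smul_eq_mul, Nat.cast_add,
    Nat.cast_mul]
  ring

/-- The log-sum has no constant term (`logCoeff u 0` is an empty sum). [folklore] -/
theorem logDiff_zero (u v : Fin m → MvPolynomial (Fin 2) ℂ) : logDiff u v 0 = 0 := by
  simp [logDiff, logCoeff]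

/-- Off the lattice `ℕ•e₁ + ℕ•e₂`, `log(1 + a X^{e₁} + b X^{e₂})` has no coefficient. [folklore] -/
theorem logCoeff_binomial_eq_zero {e₁ e₂ : Expo} (a b : ℂ) (n : Expo) (hn : ∀ p q : ℕ, p • e₁ + q • e₂ ≠ n) :
    logCoeff (monomial e₁ a + monomial e₂ b) n = 0 := by
  unfold logCoeff
  exact Finset.sum_eq_zero fun r _ => by
    rw [CommonCone.coeff_pow_eq_zero_of_forall_ne a b r n hn, mul_zero]

/-- Every support point of the log-sum of binomial tails is a lattice point `p•e₁ + q•e₂`. [folklore] -/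
theorem exists_lattice_of_mem_logSupport {e₁ e₂ : Expo} {u v : Fin m → MvPolynomial (Fin 2) ℂ}
    {a b a' b' : Fin m → ℂ} (hu : ∀ j, u j = monomial e₁ (a j) + monomial e₂ (b j))
    (hv : ∀ j, v j = monomial e₁ (a' j) + monomial e₂ (b' j)) {n : Expo} (hn : n ∈ logSupport u v) :
    ∃ p q : ℕ, p • e₁ + q • e₂ = n := by
  by_contra h
  push Not at h
  apply hn
  show logDiff u v n = 0
  unfold logDiff
  simp [hu, hv, logCoeff_binomial_eq_zero _ _ n h]

/-! ### Independent exponents: the lattice coefficient formula -/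

/-- A nonzero exponent vector has coordinate sum `≥ 1`. [folklore] -/
theorem one_le_coordSum {e : Expo} (he : e ≠ 0) : 1 ≤ e 0 + e 1 := by
  by_contra h
  apply he
  ext i
  fin_cases i <;> simp <;> omega

/-- On the lattice, the coefficient of `X^{p•e₁+q•e₂}` (`p + q ≥ 1`) in `log(1 + a X^{e₁} + b X^{e₂})` is
`κ_{pq} · a^p b^q`, `κ_{pq} = (−1)^{p+q+1} C(p+q, p)/(p+q)` (only the power `r = p + q` contributes, and the
total-degree truncation `r ≤ n₀ + n₁` does not bite). [folklore] -/
theorem logCoeff_binomial_lattice {e₁ e₂ : Expo} (hdet : e₁ 0 * e₂ 1 ≠ e₁ 1 * e₂ 0) (a b : ℂ) {p q : ℕ}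
    (hpq : 1 ≤ p + q) :
    logCoeff (monomial e₁ a + monomial e₂ b) (p • e₁ + q • e₂) =
      ((-1 : ℂ) ^ (p + q + 1) / ((p + q : ℕ) : ℂ) * (((p + q).choose p : ℕ) : ℂ)) * (a ^ p * b ^ q) := by
  classical
  obtain ⟨h1, h2, -⟩ := CommonCone.ne_zero_of_det hdet
  have hdeg : p + q ≤ (p • e₁ + q • e₂) 0 + (p • e₁ + q • e₂) 1 := by
    have h1' := one_le_coordSum h1
    have h2' := one_le_coordSum h2
    simp only [Finsupp.coe_add, Finsupp.coe_smul, Pi.add_apply, Pi.smul_apply, smul_eq_mul]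
    nlinarith
  unfold logCoeff
  simp only [CommonCone.coeff_pow_smul_add_smul hdet]
  rw [Finset.sum_eq_single (p + q)]
  · rw [if_pos rfl]; ring
  · intro r _ hr
    rw [if_neg (Ne.symm hr), mul_zero]
  · intro habs
    exact absurd (Finset.mem_Icc.2 ⟨hpq, hdeg⟩) habs

/-- The lattice scalar `κ_{pq}` is nonzero in characteristic `0`. [folklore] -/
theorem kappa_ne_zero {p q : ℕ} (hpq : 1 ≤ p + q) :
    ((-1 : ℂ) ^ (p + q + 1) / ((p + q : ℕ) : ℂ) * (((p + q).choose p : ℕ) : ℂ)) ≠ 0 := by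
  refine mul_ne_zero (div_ne_zero (pow_ne_zero _ (by norm_num)) ?_) ?_
  · exact Nat.cast_ne_zero.2 (by omega)
  · exact Nat.cast_ne_zero.2 (Nat.choose_pos (by omega)).ne'

/-- **Coefficient formula.** On a common independent cone the log-sum's coefficient at `p•e₁ + q•e₂`
(`p + q ≥ 1`) is `κ_{pq} · G(p,q)` with the signed exponential sum `G(p,q) = Σ_j a_j^p b_j^q − Σ_j a'_j^p b'_j^q`.
[folklore] -/
theorem logDiff_lattice {e₁ e₂ : Expo} (hdet : e₁ 0 * e₂ 1 ≠ e₁ 1 * e₂ 0)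
    {u v : Fin m → MvPolynomial (Fin 2) ℂ} {a b a' b' : Fin m → ℂ}
    (hu : ∀ j, u j = monomial e₁ (a j) + monomial e₂ (b j))
    (hv : ∀ j, v j = monomial e₁ (a' j) + monomial e₂ (b' j)) {p q : ℕ} (hpq : 1 ≤ p + q) :
    logDiff u v (p • e₁ + q • e₂) =
      ((-1 : ℂ) ^ (p + q + 1) / ((p + q : ℕ) : ℂ) * (((p + q).choose p : ℕ) : ℂ)) *
        (∑ j, a j ^ p * b j ^ q - ∑ j, a' j ^ p * b' j ^ q) := by
  unfold logDiff
  simp only [hu, hv, logCoeff_binomial_lattice hdet _ _ hpq]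
  rw [← Finset.mul_sum, ← Finset.mul_sum, mul_sub]

/-- If `G(p,q) ≠ 0` with `p ≥ 1`, some tail has the exponent `e₁` (its `a`-coefficient is nonzero).
[folklore] -/
theorem exists_fst_ne_zero {a b a' b' : Fin m → ℂ} {p q : ℕ} (hp : 1 ≤ p)
    (hG : (∑ j, a j ^ p * b j ^ q - ∑ j, a' j ^ p * b' j ^ q) ≠ 0) : ∃ j, a j ≠ 0 ∨ a' j ≠ 0 := by
  by_contra h
  push Not at h
  apply hG
  have hp0 : p ≠ 0 := by omega
  simp [fun j => (h j).1, fun j => (h j).2, zero_pow hp0]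

/-- If `G(p,q) ≠ 0` with `q ≥ 1`, some tail has the exponent `e₂`. [folklore] -/
theorem exists_snd_ne_zero {a b a' b' : Fin m → ℂ} {p q : ℕ} (hq : 1 ≤ q)
    (hG : (∑ j, a j ^ p * b j ^ q - ∑ j, a' j ^ p * b' j ^ q) ≠ 0) : ∃ j, b j ≠ 0 ∨ b' j ≠ 0 := by
  by_contra h
  push Not at h
  apply hG
  have hq0 : q ≠ 0 := by omega
  simp [fun j => (h j).1, fun j => (h j).2, zero_pow hq0]

/-- `G(0,0) = m − m = 0`. [folklore] -/
theorem expSum_zero_zero (a b a' b' : Fin m → ℂ) :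
    (∑ j, a j ^ 0 * b j ^ 0 - ∑ j, a' j ^ 0 * b' j ^ 0) = 0 := by
  simp

/-- **Visible points are minimal nonzeros.** On a common independent cone, a visible point of `supp D` is
`p•e₁ + q•e₂` for a nonzero `(p, q)` of `G` below which (componentwise) `G` vanishes: a smaller nonzero `(p', q')`
would be a support point of strictly larger weight, because the weight of `e₁` (resp. `e₂`) is negative for every
valid weight as soon as `e₁` (resp. `e₂`) occurs in some tail, which `G(p,q) ≠ 0` with `p ≥ 1` (resp. `q ≥ 1`)
forces. [folklore] -/
theorem minimal_of_logVisible {e₁ e₂ : Expo} (hdet : e₁ 0 * e₂ 1 ≠ e₁ 1 * e₂ 0)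
    {u v : Fin m → MvPolynomial (Fin 2) ℂ} {a b a' b' : Fin m → ℂ}
    (hu : ∀ j, u j = monomial e₁ (a j) + monomial e₂ (b j))
    (hv : ∀ j, v j = monomial e₁ (a' j) + monomial e₂ (b' j))
    (ha : ∀ j, a j ≠ 0 → e₁ ∈ (u j).support) (hb : ∀ j, b j ≠ 0 → e₂ ∈ (u j).support)
    (ha' : ∀ j, a' j ≠ 0 → e₁ ∈ (v j).support) (hb' : ∀ j, b' j ≠ 0 → e₂ ∈ (v j).support)
    {l : Expo} (hl : l ∈ logVisible u v) :
    ∃ x : ℕ × ℕ, l = x.1 • e₁ + x.2 • e₂ ∧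
      (∑ j, a j ^ x.1 * b j ^ x.2 - ∑ j, a' j ^ x.1 * b' j ^ x.2) ≠ 0 ∧
      ∀ y : ℕ × ℕ, y.1 ≤ x.1 → y.2 ≤ x.2 → y ≠ x →
        (∑ j, a j ^ y.1 * b j ^ y.2 - ∑ j, a' j ^ y.1 * b' j ^ y.2) = 0 := by
  classical
  obtain ⟨ξ, hvalid, hmem, htop⟩ := hl
  obtain ⟨p, q, rfl⟩ := exists_lattice_of_mem_logSupport hu hv hmem
  -- `(p, q) ≠ (0, 0)` since `D` has no constant term
  have hpq : 1 ≤ p + q := by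
    by_contra h0
    obtain ⟨hp0, hq0⟩ : p = 0 ∧ q = 0 := by omega
    subst hp0; subst hq0
    apply hmem
    show logDiff u v (0 • e₁ + 0 • e₂) = 0
    rw [zero_smul, zero_smul, add_zero, logDiff_zero]
  have hG : (∑ j, a j ^ p * b j ^ q - ∑ j, a' j ^ p * b' j ^ q) ≠ 0 := by
    intro h0
    apply hmem
    show logDiff u v (p • e₁ + q • e₂) = 0
    rw [logDiff_lattice hdet hu hv hpq, h0, mul_zero]
  -- negative weights of the exponents that occur
  have hw₁ : 1 ≤ p → wt ξ e₁ < 0 := by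
    intro hp
    obtain ⟨j, hj | hj⟩ := exists_fst_ne_zero hp hG
    · exact hvalid.1 j e₁ (ha j hj)
    · exact hvalid.2 j e₁ (ha' j hj)
  have hw₂ : 1 ≤ q → wt ξ e₂ < 0 := by
    intro hq
    obtain ⟨j, hj | hj⟩ := exists_snd_ne_zero hq hG
    · exact hvalid.1 j e₂ (hb j hj)
    · exact hvalid.2 j e₂ (hb' j hj)
  refine ⟨(p, q), rfl, hG, fun y hy1 hy2 hne => ?_⟩
  by_contra hGy
  -- `y ≠ (0,0)`, so `y.1•e₁ + y.2•e₂` is a support point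
  have hy : 1 ≤ y.1 + y.2 := by
    by_contra h0
    obtain ⟨h01, h02⟩ : y.1 = 0 ∧ y.2 = 0 := by omega
    rw [h01, h02] at hGy
    exact hGy (expSum_zero_zero a b a' b')
  have hmem' : y.1 • e₁ + y.2 • e₂ ∈ logSupport u v := by
    show logDiff u v (y.1 • e₁ + y.2 • e₂) ≠ 0
    rw [logDiff_lattice hdet hu hv hy]
    exact mul_ne_zero (kappa_ne_zero hy) hGy
  have hne' : y.1 • e₁ + y.2 • e₂ ≠ p • e₁ + q • e₂ := by
    intro h
    have := CommonCone.smul_add_smul_inj hdet h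
    exact hne (Prod.ext this.1 this.2)
  have hlt := htop _ hmem' hne'
  rw [wt_lattice, wt_lattice] at hlt
  -- but the smaller point weighs more
  simp only at hy1 hy2
  have t1 : 0 ≤ ((p : ℝ) - y.1) * (-wt ξ e₁) := by
    rcases Nat.eq_or_lt_of_le hy1 with h | h
    · rw [h, sub_self, zero_mul]
    · have : (y.1 : ℝ) < p := by exact_mod_cast h
      have := hw₁ (by omega)
      nlinarith
  have t2 : 0 ≤ ((q : ℝ) - y.2) * (-wt ξ e₂) := by
    rcases Nat.eq_or_lt_of_le hy2 with h | h
    · rw [h, sub_self, zero_mul]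
    · have : (y.2 : ℝ) < q := by exact_mod_cast h
      have := hw₂ (by omega)
      nlinarith
  nlinarith

/-- **Independent cone: the count.** Visible points inject into the minimal nonzeros of the rank-`≤ 2m` pattern
`G`, which number at most `2m` (the landed rank obstruction). [folklore] -/
theorem card_le_of_independent {e₁ e₂ : Expo} (hdet : e₁ 0 * e₂ 1 ≠ e₁ 1 * e₂ 0)
    {u v : Fin m → MvPolynomial (Fin 2) ℂ} {a b a' b' : Fin m → ℂ}
    (hu : ∀ j, u j = monomial e₁ (a j) + monomial e₂ (b j))
    (hv : ∀ j, v j = monomial e₁ (a' j) + monomial e₂ (b' j))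
    (ha : ∀ j, a j ≠ 0 → e₁ ∈ (u j).support) (hb : ∀ j, b j ≠ 0 → e₂ ∈ (u j).support)
    (ha' : ∀ j, a' j ≠ 0 → e₁ ∈ (v j).support) (hb' : ∀ j, b' j ≠ 0 → e₂ ∈ (v j).support)
    (S : Finset Expo) (hS : ↑S ⊆ logVisible u v) : S.card ≤ 2 * m := by
  classical
  have key : ∀ l ∈ S, ∃ x : ℕ × ℕ, l = x.1 • e₁ + x.2 • e₂ ∧
      (∑ j, a j ^ x.1 * b j ^ x.2 - ∑ j, a' j ^ x.1 * b' j ^ x.2) ≠ 0 ∧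
      ∀ y : ℕ × ℕ, y.1 ≤ x.1 → y.2 ≤ x.2 → y ≠ x →
        (∑ j, a j ^ y.1 * b j ^ y.2 - ∑ j, a' j ^ y.1 * b' j ^ y.2) = 0 :=
    fun l hl => minimal_of_logVisible hdet hu hv ha hb ha' hb' (hS (Finset.mem_coe.2 hl))
  choose! π hπ1 hπ2 hπ3 using key
  have hinj : Set.InjOn π ↑S := fun l hl l' hl' h => by
    rw [hπ1 l hl, hπ1 l' hl', h]
  rw [← Finset.card_image_of_injOn hinj, two_mul]
  refine CommonCone.card_le_of_minimal_nonzeros _ _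
    (fun p q => ∑ j, a j ^ p * b j ^ q - ∑ j, a' j ^ p * b' j ^ q)
    (fun p q => CommonCone.expSum_sub_expSum_eq a b a' b' p q) _ ?_ ?_
  · simp only [Finset.mem_image]
    rintro _ ⟨l, hl, rfl⟩
    exact hπ2 l hl
  · simp only [Finset.mem_image]
    rintro _ ⟨l, hl, rfl⟩
    exact hπ3 l hl


end Summit.ValiantsHypothesis.ValiantsHypothesis.Theorems.NewtonUnitEquations.TwoProducts.FormalLogLinearisation

end
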